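import Summits.CriticalPhenomena.SAWScalingLimit.Theorems.SAWDevelopingMapObservableToSLETypeLadderBandDefs
import HarnessLib

/-!
# A good gate from adapted band success (band iteration, piece I5)

Stub `stub_goodRenewal_of_bandSuccess` (line `six-class-type-ladder`, skeleton r16: band-wise cut of the abundance
residue) of the crux `Summit.CriticalPhenomena.SAWScalingLimit.Theses.SAWDevelopingMap.ObservableToSLE`
(item stmt-CriticalPhenomena-10472).

In the band iteration a level `S n` of the designer family is GOOD for the walk `l` (`GoodRenewalAtN`) when the
walk's first exit from `S n` is through a clean window, the walk NEVER returns to `S n`, and the gate has a wide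
escape.  Adapted band success (`BandSuccess`) gives the clean first exit and no return WHILE the walk stays
`P`-close to the rescaled root; the failure of the macroscopic-backtracking event (no entry `u` that is `R′`-far
from the point `z` followed LATER by an entry `v` that is `r`-close to `z`) forbids returns AFTER the walk got
`P`-far: all levels are `r`-close to `z`, and `P`-far from the rescaled root means `R′`-far from `z` by the
triangle inequality with `dist (δc) z ≤ P − R′`.  Finally the `z₀`-escape of the clean window is a wide escape
by `wideEscape_of_zEscape`.  Pure bookkeeping on lists and one triangle inequality; no literature input.

* `exists_split_of_lt` — `l = l.take k' ++ l[k'] :: l.drop (k' + 1)` with `l[k] ∈ l.drop (k' + 1)` for `k' < k`;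
* `stub_goodRenewal_of_bandSuccess` — the registered stub.
-/

noncomputable section

open scoped BigOperators Topology NNReal ENNReal Classical
open Filter Set MeasureTheory Metric
open Literature.Probability.LatticeModels (HexVertex hexGraph hexCenter triZeta Site)
open Literature.Probability.RandomPlanarGeometry
open Literature.Probability.RandomPlanarGeometry.SAW

namespace Summit.CriticalPhenomena.SAWScalingLimit.Theorems.ObservableToSLE.TypeLadder

open Summit.CriticalPhenomena.SAWScalingLimit.Theorems.ObservableToSLER.BridgeGate
  (hexBall HasCleanWindow carvedLaw rowOf)
open Summit.CriticalPhenomena.SAWScalingLimit.Theorems.ObservableToSLER.NestedGate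

/-- **Splitting a list at an earlier index.**  For indices `k' < k < l.length` the list decomposes as
`l = l.take k' ++ l[k'] :: l.drop (k' + 1)` and the later entry `l[k]` lies in the final segment
`l.drop (k' + 1)` — the shape of the macroscopic-backtracking event. -/
theorem exists_split_of_lt {α : Type*} (l : List α) {k' k : ℕ} (hk'k : k' < k) (hk : k < l.length) :
    ∃ l₁ l₂ : List α, l = l₁ ++ l[k']'(hk'k.trans hk) :: l₂ ∧ l[k] ∈ l₂ := by
  refine ⟨l.take k', l.drop (k' + 1), ?_, ?_⟩
  · rw [← List.drop_eq_getElem_cons (hk'k.trans hk), List.take_append_drop]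
  · rw [List.mem_iff_getElem]
    refine ⟨k - (k' + 1), by rw [List.length_drop]; omega, ?_⟩
    rw [List.getElem_drop]
    congr 1
    omega

/-- **A good gate from adapted band success** (registered stub `stub_goodRenewal_of_bandSuccess`, crux item
stmt-CriticalPhenomena-10472, skeleton r16, piece I5 of the band iteration).  If the list `l` has adapted band
success at the family `S` with protection radius `P` (a clean first exit from some level `S n`, no return to
`S n` while all intermediate entries stay `P`-close to the rescaled root `c`), if the macroscopic-backtracking
event "an entry `R′`-far from `z`, LATER an entry `r`-close to `z`" fails for `l`, if every level is `r`-close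
to `z` and the rescaled root is `(P − R′)`-close to `z`, and if every clean window of every level has a
`z₀`-escape with `z₀` at distance `≥ 2R` from the rescaled root, then `l` has a good gate at some level
(`GoodRenewalAtN`): the never-return clause after the walk got `P`-far follows from the triangle inequality,
and the wide escape from `wideEscape_of_zEscape`.  (The outer-radius hypotheses are part of the registered
signature and not needed for the conclusion.) -/
theorem stub_goodRenewal_of_bandSuccess :
    ∀ (Ω : Set ℂ) (δ ρ R P ρout R' r Rfar : ℝ) (z z₀ w : ℂ) (S : ℕ → Set HexVertex) (c : HexVertex)
      (l : List HexVertex),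
      BandSuccess Ω δ ρ P S c l →
      (¬ ∃ (l₁ l₂ : List HexVertex) (u v : HexVertex), l = l₁ ++ u :: l₂ ∧ v ∈ l₂ ∧
          R' ≤ dist ((δ : ℂ) * hexCenter u) z ∧ dist ((δ : ℂ) * hexCenter v) z ≤ r) →
      (∀ n, ∀ v ∈ S n, dist ((δ : ℂ) * hexCenter v) z ≤ r) →
      (∀ n, ∀ v ∈ S n, dist ((δ : ℂ) * hexCenter v) ((δ : ℂ) * hexCenter c) ≤ ρout) → ρout < P →
      dist ((δ : ℂ) * hexCenter c) z ≤ P - R' →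
      (∀ (n : ℕ) (p q : HexVertex), HasCleanWindow Ω δ ρ (S n) p q → ZEscape Ω δ ρ Rfar z₀ w (S n) q) →
      2 * R ≤ dist z₀ ((δ : ℂ) * hexCenter c) →
      GoodRenewalAtN Ω δ ρ R S c l := by
  intro Ω δ ρ R P ρout R' r Rfar z z₀ w S c l hband hnoback hSr _hSout _hP hcz hesc hz₀
  obtain ⟨n, m, p, q, hexit, hwin, hnoret⟩ := hband
  refine ⟨n, m, p, q, hexit, ?_, hwin, wideEscape_of_zEscape (hesc n p q hwin) hz₀⟩
  -- the never-return clause: an entry `l[m + i]` after the exit index lies outside `S n`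
  intro v hv
  obtain ⟨i, hi, rfl⟩ := List.mem_iff_getElem.1 hv
  rw [List.length_drop] at hi
  rw [List.getElem_drop]
  by_cases hall : ∀ (k' : ℕ) (hk' : k' < l.length), m ≤ k' → k' < m + i →
      dist ((δ : ℂ) * hexCenter (l[k']'hk')) ((δ : ℂ) * hexCenter c) < P
  · -- all intermediate entries are `P`-close to the root: band success applies verbatim
    exact hnoret (m + i) (by omega) (by omega) hall
  · -- some intermediate entry `l[k']` is `P`-far from the root, hence `R′`-far from `z`; a return to
    -- `S n` at `l[m + i]` would be `r`-close to `z`, i.e. the forbidden backtracking event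
    simp only [not_forall, not_lt] at hall
    obtain ⟨k', hk', hmk', hk'k, hfar⟩ := hall
    intro hmem
    apply hnoback
    obtain ⟨l₁, l₂, hl, hl₂⟩ := exists_split_of_lt l hk'k (by omega)
    refine ⟨l₁, l₂, l[k'], l[m + i], hl, hl₂, ?_, hSr n _ hmem⟩
    have htri := dist_triangle ((δ : ℂ) * hexCenter (l[k'])) z ((δ : ℂ) * hexCenter c)
    rw [dist_comm z] at htri
    linarith

end Summit.CriticalPhenomena.SAWScalingLimit.Theorems.ObservableToSLE.TypeLadder

end
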